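import Summits.BirchSwinnertonDyer.BirchSwinnertonDyer.Theorems.UniversalToricDescentRelaxedDualTransfer
import Summits.BirchSwinnertonDyer.BirchSwinnertonDyer.Theorems.UniversalToricDescentRelaxedLayerSelmer
import Summits.BirchSwinnertonDyer.Rank1Residual.X11b.BDPRouteSelmerLevelBound
import Summits.BirchSwinnertonDyer.Rank1Residual.X11b.CoinvariantsLocal
import HarnessLib

/-!
# The RELAXED Kummer groups `KO_L(T ∪ V) ⊇ KO_L(T)` through a transport `(Φ^M, Φ)`: images in `Sel^{S′}_{v₀}(K_∞, E[p^∞])`, vanishing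
# `v`-signatures of `KO_L(T)`, finiteness (crux ♭T≤ stmt-BirchSwinnertonDyer-23042, line `sigmacongruence`, stub R1 `stub_relaxedImageCount`, brick (f) part 1)

Route `UniversalToricDescent`, lead prover `bsd-wall-utd-p1` g18. THEOREMS ONLY (no definition, no named fact, no `sorry`);
`--supports stmt-BirchSwinnertonDyer-23042`. BSD is not proved by any of this.

Setting as in `…RelaxedDualTransfer`, but for the RELAXED structures of `…RelaxedKummerPairCountStrict`:
`KO_L(T) = H¹_{kummerRelaxed(T_L ∪ ∞)}(L, E_L[p^k])` (no condition over `T_K` and at infinity, Kummer elsewhere) and `KO_L(T ∪ V)` (also relaxed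
over `v`), with a level-`p^k` transport `(Φ^M, Φ)` for `U = Γ_n` (hypotheses `hkum`, `htors`).

* §1 `mem_kummerRelaxed_iff_mem_union` — `z ∈ KO_L(T)` iff `z ∈ KO_L(T ∪ V)` and `z` is Kummer at every place over `v`;
  `finite_kummerRelaxed` — these groups are finite (`X11b.SelmerLevelBound.finite_kummerOutside`).
* §2 `classical_of_mem_kummerRelaxed_union` — `y ∈ KO_L(T ∪ V)` ⟹ `conj_σ (Φ y)` classical at every finite `u ∉ T_K`, `u ≠ v`;
  `layerToInfty_mem_selmerAc_of_mem_kummerRelaxed_union` — hence `h_n (Φ y) ∈ Sel^{S′}_{v₀}(K_∞, E[p^∞])` (tame `v₀ ∉ S′`) whenever every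
  tame `u ∉ S′` is off `T_K ∪ {v}`, and `p^k h_n (Φ y) = 0`.
* §3 `resKerD_conjH1_layerToInfty_eq_zero_of_mem_kummerRelaxed` — for `y ∈ KO_L(T)` (Kummer over `v`, `v ∤ p`, `v ∉ T_K`) every
  `v`-signature `resKerD (conj_σ (h_n (Φ y)))` vanishes (classical ⟹ locally trivial over `K_∞`, Greenberg Prop. 2.1).

References: [MilneADT2006] I.§6 (Lemma 6.15); [GreenbergLNM1716] §2 Prop. 2.1 (p. 72); [Howard2004HeegnerKolyvagin] Def. 2.1.1;
[Castella2018] Def. 2.2.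
-/

set_option linter.dupNamespace false
set_option autoImplicit false

noncomputable section
open scoped Classical
open CategoryTheory Field NumberField IsDedekindDomain Function
open Literature.NumberTheory.EllipticCurves Literature.NumberTheory.EllipticCurves.GreenbergSelmer
open Literature.NumberTheory.GaloisRepresentations
open Literature.NumberTheory.GaloisRepresentations.DiscreteGaloisModule (SelmerStructure)
open Literature.NumberTheory.GaloisCohomology
open scoped ContRepresentation
open scoped NumberField.LiesOver

namespace Summit.BirchSwinnertonDyer.BirchSwinnertonDyer.Theorems.UniversalToricDescentRelaxedKummerImage

open Summit.BirchSwinnertonDyer.Rank1Residual.X11b.KummerPT Summit.BirchSwinnertonDyer.Rank1Residual.X11b.LocBridge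
  Summit.BirchSwinnertonDyer.Rank1Residual.X11b.Coinv Summit.BirchSwinnertonDyer.Rank1Residual.X11b.AcSelmer
  Summit.BirchSwinnertonDyer.BirchSwinnertonDyer.Theorems.SignedEC.RelaxedKummerCount
  Summit.BirchSwinnertonDyer.Rank1Residual.Additive
  Summit.BirchSwinnertonDyer.BirchSwinnertonDyer.Theorems.UniversalToricDescentRelaxedDualTransfer
  Summit.BirchSwinnertonDyer.BirchSwinnertonDyer.Theorems.UniversalToricDescentRelaxedLayerSelmer

variable {K : Type} [Field K] [NumberField K] (W : WeierstrassCurve K) [W.IsElliptic] (p k : ℕ) [Fact p.Prime]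
  (TK : Finset (HeightOneSpectrum (𝓞 K))) (v : HeightOneSpectrum (𝓞 K))
  (L : Type) [Field L] [NumberField L] [Algebra K L]
  (TL : Finset (HeightOneSpectrum (𝓞 L))) (hTL : ∀ w, w ∈ TL ↔ w.under (𝓞 K) ∈ TK)
  (VL : Finset (HeightOneSpectrum (𝓞 L))) (hVL : ∀ w, w ∈ VL ↔ w.under (𝓞 K) = v)

/-! ## §1 `KO_L(T)` inside `KO_L(T ∪ V)`; finiteness -/

omit [W.IsElliptic] [Fact p.Prime] [NumberField K] in
include hTL hVL in
/-- **`z ∈ KO_L(T)` iff `z ∈ KO_L(T ∪ V)` and `z` is Kummer at every place over `v`** (`v ∉ T_K`).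
[cite: Howard2004HeegnerKolyvagin, Def. 2.1.1] [cite: MilneADT2006, Ch. I §6, Lemma 6.15] -/
theorem mem_kummerRelaxed_iff_mem_union (hvT : v ∉ TK)
    (z : galoisCohomology ((W.baseChange L).torsionGaloisModule ((p ^ k : ℕ) : ℤ)) 1) :
    z ∈ (kummerRelaxed (W.baseChange L) (p ^ k) (TL.image Sum.inr ∪ Finset.univ.image Sum.inl)).selmerGroup ↔
      z ∈ (kummerRelaxed (W.baseChange L) (p ^ k) ((TL.image Sum.inr ∪ Finset.univ.image Sum.inl) ∪ VL.image Sum.inr)).selmerGroup ∧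
        ∀ w : HeightOneSpectrum (𝓞 L), w.asIdeal.LiesOver v.asIdeal →
          galoisCohomology.res ((W.baseChange L).torsionGaloisModule ((p ^ k : ℕ) : ℤ)) (w.adicCompletion L) 1 z ∈
            (W.baseChange L).kummerLocalConditionAt ((p ^ k : ℕ) : ℤ) (w.adicCompletion L) := by
  rw [selmerGroup_kummerRelaxed, selmerGroup_kummerRelaxed, mem_kummerOutside_iff, mem_kummerOutside_iff]
  constructor
  · intro h
    refine ⟨fun w' hw' ↦ h w' (fun hm ↦ hw' (Finset.mem_union_left _ hm)), fun w hw ↦ ?_⟩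
    have hw' : w.under (𝓞 K) = v := (liesOver_iff_under_eq w v).mp hw
    have hnot : (Sum.inr w : Place L) ∉ TL.image Sum.inr ∪ Finset.univ.image Sum.inl := by
      rw [inr_mem_iff TK L TL hTL, hw']
      exact hvT
    exact h (Sum.inr w) hnot
  · rintro ⟨h, hv⟩ w' hw'
    rcases w' with w' | w'
    · exact absurd (inl_mem L TL w') hw'
    · by_cases hw'v : w'.under (𝓞 K) = v
      · exact hv w' ((liesOver_iff_under_eq w' v).mpr hw'v)
      · refine h (Sum.inr w') (fun hm ↦ ?_)
        rcases Finset.mem_union.mp hm with hm | hm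
        · exact hw' hm
        · rw [Finset.mem_image] at hm
          obtain ⟨w'', hw'', he⟩ := hm
          cases he
          exact hw'v ((hVL w').mp hw'')

omit [NumberField K] in
/-- The relaxed Kummer groups are finite (`kummerOutside` of a finite module is finite, Milne I.6.15).
[cite: MilneADT2006, Ch. I §6, Lemma 6.15] -/
theorem finite_kummerRelaxed (S' : Finset (Place L)) :
    Finite (kummerRelaxed (W.baseChange L) (p ^ k) S').selmerGroup := by
  haveI : NeZero (p ^ k) := ⟨pow_ne_zero k (Fact.out : p.Prime).ne_zero⟩
  rw [selmerGroup_kummerRelaxed]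
  exact Summit.BirchSwinnertonDyer.Rank1Residual.X11b.SelmerLevelBound.finite_kummerOutside (W.baseChange L) (p ^ k) S'

/-! ## §2 `KO_L(T ∪ V)` through the transport: classical off `T_K ∪ {v}`, image in `Sel^{S′}_{v₀}(K_∞, E[p^∞])` -/

section Transport

variable (κ : ZpExtension K p) (n : ℕ)
  (Φ : galoisCohomology ((W.baseChange L).torsionGaloisModule ((p ^ k : ℕ) : ℤ)) 1 →+ W.subgroupH1 p (κ.layerSubgroup n))
  (htors : ∀ x, p ^ k • Φ x = 0)
  (hkum : ∀ (u : HeightOneSpectrum (𝓞 K)) (x : galoisCohomology ((W.baseChange L).torsionGaloisModule ((p ^ k : ℕ) : ℤ)) 1),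
    (∀ w : HeightOneSpectrum (𝓞 L), w.asIdeal.LiesOver u.asIdeal →
      galoisCohomology.res ((W.baseChange L).torsionGaloisModule ((p ^ k : ℕ) : ℤ)) (w.adicCompletion L) 1 x ∈
        (W.baseChange L).kummerLocalConditionAt ((p ^ k : ℕ) : ℤ) (w.adicCompletion L)) ↔
    ∀ σ : absoluteGaloisGroup K, W.conjH1 p (κ.layerSubgroup n) σ (Φ x) ∈ W.localKerOver p (κ.layerSubgroup n) (u.adicCompletion K))

omit [W.IsElliptic] in
include hkum hTL hVL in
/-- **`y ∈ KO_L(T ∪ V)` ⟹ `conj_σ (Φ y)` classical at every finite `u ∉ T_K`, `u ≠ v`** (Kummer at the places over `u`, Kummer dictionary).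
[cite: GreenbergLNM1716, §2 (pp. 62–63)] -/
theorem classical_of_mem_kummerRelaxed_union
    {y : galoisCohomology ((W.baseChange L).torsionGaloisModule ((p ^ k : ℕ) : ℤ)) 1}
    (hy : y ∈ (kummerRelaxed (W.baseChange L) (p ^ k) ((TL.image Sum.inr ∪ Finset.univ.image Sum.inl) ∪ VL.image Sum.inr)).selmerGroup)
    {u : HeightOneSpectrum (𝓞 K)} (hu : u ∉ TK) (huv : u ≠ v) (σ : absoluteGaloisGroup K) :
    W.conjH1 p (κ.layerSubgroup n) σ (Φ y) ∈ W.localKerOver p (κ.layerSubgroup n) (u.adicCompletion K) := by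
  rw [selmerGroup_kummerRelaxed, mem_kummerOutside_iff] at hy
  refine (hkum u y).mp (fun w hw ↦ ?_) σ
  have hw' : w.under (𝓞 K) = u := (liesOver_iff_under_eq w u).mp hw
  refine hy (Sum.inr w) (fun hm ↦ ?_)
  rcases Finset.mem_union.mp hm with hm | hm
  · rw [inr_mem_iff TK L TL hTL, hw'] at hm
    exact hu hm
  · rw [Finset.mem_image] at hm
    obtain ⟨w'', hw'', he⟩ := hm
    cases he
    exact huv (hw'.symm.trans ((hVL w).mp hw''))

include hkum htors hTL hVL in
/-- **`h_n (Φ y) ∈ Sel^{S′}_{v₀}(K_∞, E[p^∞])` and `p^k h_n (Φ y) = 0` for `y ∈ KO_L(T ∪ V)`** (`K` totally complex, `v₀` tame, `v₀ ∉ S′`,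
and every tame `u ∉ S′` off `T_K ∪ {v}`). [cite: GreenbergLNM1716, §2 Prop. 2.1 (p. 72)] [cite: Castella2018, Def. 2.2 (arXiv:1704.06608 p. 5)] -/
theorem layerToInfty_mem_selmerAc_of_mem_kummerRelaxed_union [IsTotallyComplex K] (S' : Set (HeightOneSpectrum (𝓞 K)))
    (hS' : ∀ u : HeightOneSpectrum (𝓞 K), ((p : ℕ) : 𝓞 K) ∉ u.asIdeal → u ∉ S' → u ∉ TK ∧ u ≠ v)
    (v₀ : HeightOneSpectrum (𝓞 K)) (hv₀ : ((p : ℕ) : 𝓞 K) ∉ v₀.asIdeal) (hv₀S : v₀ ∉ S')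
    {y : galoisCohomology ((W.baseChange L).torsionGaloisModule ((p ^ k : ℕ) : ℤ)) 1}
    (hy : y ∈ (kummerRelaxed (W.baseChange L) (p ^ k) ((TL.image Sum.inr ∪ Finset.univ.image Sum.inl) ∪ VL.image Sum.inr)).selmerGroup) :
    W.layerToInfty κ n (Φ y) ∈ selmerAc W p κ v₀ S' ∧ p ^ k • W.layerToInfty κ n (Φ y) = 0 := by
  refine ⟨layerToInfty_mem_selmerAc_of_classical_off W p κ S' v₀ hv₀ hv₀S n (Φ y) (fun u hu huS σ ↦ ?_), ?_⟩
  · obtain ⟨huT, huv⟩ := hS' u hu huS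
    exact classical_of_mem_kummerRelaxed_union W p k TK v L TL hTL VL hVL κ n Φ hkum hy huT huv σ
  · rw [← map_nsmul, htors, map_zero]

/-! ## §3 Classes of `KO_L(T)` have vanishing `v`-signatures -/

include hkum hTL hVL in
/-- **For `y ∈ KO_L(T)` (`v ∉ T_K`, `v ∤ p`): `resKerD (conj_σ (h_n (Φ y))) = 0` for every `σ`** — Kummer over `v` ⟹ classical at `v` over
`Γ_n` ⟹ over `K_∞` ⟹ locally trivial (Greenberg Prop. 2.1, `v ∤ p`). [cite: GreenbergLNM1716, §2 Prop. 2.1 (p. 72)] -/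
theorem resKerD_conjH1_layerToInfty_eq_zero_of_mem_kummerRelaxed (hvT : v ∉ TK) (hpv : ((p : ℕ) : 𝓞 K) ∉ v.asIdeal)
    {y : galoisCohomology ((W.baseChange L).torsionGaloisModule ((p ^ k : ℕ) : ℤ)) 1}
    (hy : y ∈ (kummerRelaxed (W.baseChange L) (p ^ k) (TL.image Sum.inr ∪ Finset.univ.image Sum.inl)).selmerGroup)
    (σ : absoluteGaloisGroup K) :
    resKerD κ (W.geomPrimaryTorsion p) v (W.conjH1 p κ.kerSubgroup σ (W.layerToInfty κ n (Φ y))) = 0 := by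
  rw [← mem_awayKer_iff_resKerD_eq_zero]
  obtain ⟨hy', hv⟩ := (mem_kummerRelaxed_iff_mem_union W p k TK v L TL hTL VL hVL hvT y).mp hy
  have hcl : W.conjH1 p (κ.layerSubgroup n) σ (Φ y) ∈ W.localKerOver p (κ.layerSubgroup n) (v.adicCompletion K) := (hkum v y).mp hv σ
  have e := congrArg (fun f ↦ f (Φ y)) (resOfLe_comp_conjH1_holds (M := W.geomPrimaryTorsion p) (κ.kerSubgroup_le_layerSubgroup n) σ)
  simp only [AddMonoidHom.coe_comp, Function.comp_apply] at e
  change W.conjH1 p κ.kerSubgroup σ (W.resOfLe p (κ.kerSubgroup_le_layerSubgroup n) (Φ y)) ∈ _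
  rw [← e]
  exact localKerOver_le_awayKer p κ v W hpv (W.resOfLe_mem_localKerOver p _ (κ.kerSubgroup_le_layerSubgroup n) hcl)

end Transport

end Summit.BirchSwinnertonDyer.BirchSwinnertonDyer.Theorems.UniversalToricDescentRelaxedKummerImage

end
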